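import Literature.Geometry.Manifold.DeRhamLocalToSubset
import Literature.Geometry.Manifold.DeRhamComparison
import Literature.AlgebraicTopology.SingularHomology.SubsetCochainsComparisonPull
import HarnessLib

/-!
# The de Rham comparison isomorphism through `Θ⁻¹ : Hᵏ(M; ℝ) → Hᵏ_M(univ)`

The tree has two comparisons of the cohomology of `M` computed on the chains in `univ`
(`subsetCochains ℝ ℝ̃ univ`) with Mathlib's singular cohomology: the map
`Θ⁻¹ : Hᵏ(M; ℝ) → Hᵏ_M(univ)` of `CechCapBridge` (`subsetCochains.thetaInv`, `[φ] ↦ [coext φ]`) and the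
chain of isomorphisms `singIso`, restriction to all chains, behind the de Rham comparison
`deRhamComparisonIso : Hᵏ(Ω•(univ)) ≅ Hᵏ(M; ℝ)` of `DeRhamComparison`.  We identify them:

* `coext φ` IS the cochain `φ` transported along `singIso` and restricted to the chains in `univ`
  (`coext_eq_dualMap_singIso`), so `Θ⁻¹ = H(restriction) ∘ H(singIso)` (`thetaInv_eq_homologyMap`);
* consequently **`Θ⁻¹ ∘ deRhamComparisonIso = Ψ'`**, the comparison
  `localDeRhamToSubset : Hᵏ(Ω•(univ)) → Hᵏ_M(univ)` of `DeRhamLocalToSubset`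
  (`thetaInv_deRhamComparisonIso`);
* `Θ⁻¹` is bijective (`thetaInv_bijective`).

Everything is proved; no named facts.

## References

* [HatcherAT2002] A. Hatcher, *Algebraic Topology*, CUP 2002, §3.1 p. 197.
* [Bredon1993] G. E. Bredon, *Topology and Geometry*, GTM 139 (1993), §V.9 Thm. V.9.5.
-/

noncomputable section

-- see "Implementation notes" in `…SingularHomology.SingularChainsConcrete`
set_option backward.isDefEq.respectTransparency false

open scoped Manifold ContDiff Topology
open CategoryTheory Limits Set Function Literature.AlgebraicTopology.SingularHomology Literature.Geometry.Kaehler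

universe u

namespace Literature.Geometry.Manifold

variable {E : Type u} [NormedAddCommGroup E] [NormedSpace ℝ E] {H : Type u} [TopologicalSpace H]
  {I : ModelWithCorners ℝ E H} {M : Type u} [TopologicalSpace M] [ChartedSpace H M] {k : ℕ}

/-! ### `coext` is `singIso` followed by restriction to the chains in `univ` -/

/-- **`coext φ = (φ ∘ singIso)|_{C(univ)}`**: the cochain of `Hom(C_M(univ), ℝ̃)` attached to a singular
cochain `φ` by `coext` is `φ` read as a functional on all concrete chains (`singIso`) restricted to the
chains in `univ`. [cite: HatcherAT2002, §3.1 p. 197] -/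
theorem coext_eq_dualMap_singIso (φ : (singularCochainComplex ℝ ℝ M).X k) :
    subsetCochains.coext φ =
      (dualMap ℝ realCoeff.{u} (chainsInSub ℝ ℝ M (univ : Set M)).ι).f k ((singIso M).hom.f k φ) := by
  refine subsetCochains.eq_of_toFun_eq (funext fun σ ↦ ?_)
  rw [subsetCochains.toFun_coext, dualMap_f_apply]
  have hσ : Finsupp.single σ (1 : ℝ) ∈ chainsInSub ℝ ℝ M (univ : Set M) k :=
    (SimplexSpan.ofSet (R := ℝ) (univ : Set M)).single_mem (subsetCochains.mem_ofSet_univ σ) 1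
  have h := subsetCochains.apply_single_eq_up_toFun
    ((chainsInSub ℝ ℝ M (univ : Set M)).ι.f k ≫ (singIso M).hom.f k φ) σ hσ
  rw [ModuleCat.comp_apply, Subcomplex.ι_f_apply, singIso_hom_f_apply_single, one_mul] at h
  exact ULift.up_injective h

/-- **`Θ⁻¹ = H(restriction to C(univ)) ∘ H(singIso)`.** [cite: HatcherAT2002, §3.1 p. 197] -/
theorem thetaInv_eq_homologyMap (z : singularCohomology ℝ ℝ M k) :
    subsetCochains.thetaInv k z =
      HomologicalComplex.homologyMap (dualMap ℝ realCoeff.{u} (chainsInSub ℝ ℝ M (univ : Set M)).ι) k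
        (HomologicalComplex.homologyMap (singIso M).hom k z) := by
  obtain ⟨φ, hφ, rfl⟩ := homologyCls_surjective (K := singularCochainComplex ℝ ℝ M) (i := k) z
  rw [subsetCochains.thetaInv_homologyCls k φ hφ (subsetCochains.d_coext_of_mem_ker k ⟨φ, hφ⟩),
    homologyMap_homologyCls, homologyMap_homologyCls]
  exact homologyCls_congr (coext_eq_dualMap_singIso φ) _ _

/-! ### `Θ⁻¹ ∘ comparison = Ψ'` -/

variable [IsManifold I ∞ M] [I.Boundaryless] [FiniteDimensional ℝ E] [T2Space M] [SecondCountableTopology M]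
  [LocallyCompactSpace M]

/-- **The two de Rham comparisons agree**: `Θ⁻¹ (deRhamComparisonIso x) = Ψ'_M x` in `Hᵏ_M(univ)`
for every `x ∈ Hᵏ(Ω•(univ))` (both are "integrate the form over the chains of `M`": test with the
injective restriction to smooth chains, `deRhamComparisonIso_hom_comp`, `toSmoothAll_eq`,
`localDeRhamToSubset_comp_toSmooth`). [cite: Bredon1993, Thm. V.9.5] -/
theorem thetaInv_deRhamComparisonIso (x : (localDeRhamComplex I ℝ (isOpen_univ : IsOpen (univ : Set M))).homology k) :
    subsetCochains.thetaInv k ((deRhamComparisonIso I M k).hom x) =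
      localDeRhamToSubset I (isOpen_univ : IsOpen (univ : Set M)) k x := by
  haveI : Fact (IsOpen (univ : Set M)) := ⟨isOpen_univ⟩
  -- test with `H(toSmooth_univ)`, an isomorphism
  apply ((ConcreteCategory.isIso_iff_bijective _).1
    (isIso_homologyMap_toSmooth (I := I) (W := (univ : Set M)) k)).1
  -- the right-hand side is `H(Ψ_univ) x`
  have hR : HomologicalComplex.homologyMap (smoothSubsetCochains.toSmooth I ℝ realCoeff.{u} (univ : Set M)) k
      (localDeRhamToSubset I (isOpen_univ : IsOpen (univ : Set M)) k x) =
      HomologicalComplex.homologyMap (deRhamMap I (isOpen_univ : IsOpen (univ : Set M))) k x := by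
    rw [← ModuleCat.comp_apply, localDeRhamToSubset_comp_toSmooth]
  -- the left-hand side is `H(toSmoothAll)(H(singIso)(comparison x)) = H(Ψ_univ) x`
  have hfac : dualMap ℝ realCoeff.{u} (chainsInSub ℝ ℝ M (univ : Set M)).ι ≫
      smoothSubsetCochains.toSmooth I ℝ realCoeff.{u} (univ : Set M) = toSmoothAll I M := by
    rw [smoothSubsetCochains.toSmooth, ← dualMap_comp, Subcomplex.incl_ι]
  have hL := congrArg (fun φ ↦ (ModuleCat.Hom.hom φ) x) (deRhamComparisonIso_hom_comp (I := I) (M := M) k)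
  simp only [ModuleCat.hom_comp, LinearMap.comp_apply] at hL
  rw [hR, ← hL, thetaInv_eq_homologyMap, ← ModuleCat.comp_apply, ← HomologicalComplex.homologyMap_comp, hfac]
  rfl

omit [IsManifold I ∞ M] [I.Boundaryless] [FiniteDimensional ℝ E] [T2Space M] [SecondCountableTopology M]
  [LocallyCompactSpace M] [ChartedSpace H M] in
/-- Pull-back along a homeomorphism is injective on singular cohomology. [folklore] -/
theorem singularCohomology_map_injective_of_homeomorph {X Y : Type u} [TopologicalSpace X] [TopologicalSpace Y]
    (e : X ≃ₜ Y) (n : ℕ) : Injective (singularCohomology.map ℝ ℝ (⟨e, e.continuous⟩ : C(X, Y)) n) := by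
  have h : singularCohomology.map ℝ ℝ (⟨e, e.continuous⟩ : C(X, Y)) n ≫
      singularCohomology.map ℝ ℝ (⟨e.symm, e.symm.continuous⟩ : C(Y, X)) n = 𝟙 _ := by
    rw [← singularCohomology.map_comp]
    have : (⟨e, e.continuous⟩ : C(X, Y)).comp (⟨e.symm, e.symm.continuous⟩ : C(Y, X)) = ContinuousMap.id Y := by
      ext y
      exact e.apply_symm_apply y
    rw [this, singularCohomology.map_id]
  intro a b hab
  have := congrArg (singularCohomology.map ℝ ℝ (⟨e.symm, e.symm.continuous⟩ : C(Y, X)) n) hab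
  rwa [← ModuleCat.comp_apply, ← ModuleCat.comp_apply, h, ModuleCat.id_apply, ModuleCat.id_apply] at this

omit [IsManifold I ∞ M] [I.Boundaryless] [FiniteDimensional ℝ E] [T2Space M] [SecondCountableTopology M]
  [LocallyCompactSpace M] [ChartedSpace H M] in
/-- **`Θ⁻¹` is injective** (`iso_univ ∘ Θ⁻¹ = val^*` with `val : ↥univ ≃ M`). [cite: HatcherAT2002, §3.1 p. 197] -/
theorem thetaInv_injective : Injective (subsetCochains.thetaInv (R := ℝ) (X := M) k) := by
  intro a b hab
  have h := congrArg (subsetCochains.homologyIsoSingularCohomology ℝ (univ : Set M) k).hom hab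
  rw [subsetCochains.homologyIsoSingularCohomology_hom_thetaInv, subsetCochains.homologyIsoSingularCohomology_hom_thetaInv] at h
  exact singularCohomology_map_injective_of_homeomorph (Homeomorph.Set.univ M) k h

omit [IsManifold I ∞ M] [I.Boundaryless] [FiniteDimensional ℝ E] [T2Space M] [SecondCountableTopology M]
  [LocallyCompactSpace M] [ChartedSpace H M] in
/-- **`Θ⁻¹` is surjective** (`iso_univ ∘ Θ⁻¹ = val^*`, both isomorphisms). [cite: HatcherAT2002, §3.1 p. 197] -/
theorem thetaInv_surjective : Surjective (subsetCochains.thetaInv (R := ℝ) (X := M) k) := by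
  intro y
  -- `val^*` is surjective: `val` is a homeomorphism
  have hsurj : Surjective (singularCohomology.map ℝ ℝ
      (⟨Homeomorph.Set.univ M, (Homeomorph.Set.univ M).continuous⟩ : C(↥(univ : Set M), M)) k) := by
    intro w
    refine ⟨singularCohomology.map ℝ ℝ (⟨(Homeomorph.Set.univ M).symm, (Homeomorph.Set.univ M).symm.continuous⟩ :
      C(M, ↥(univ : Set M))) k w, ?_⟩
    rw [← ModuleCat.comp_apply, ← singularCohomology.map_comp]
    have : (⟨(Homeomorph.Set.univ M).symm, (Homeomorph.Set.univ M).symm.continuous⟩ : C(M, ↥(univ : Set M))).comp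
        (⟨Homeomorph.Set.univ M, (Homeomorph.Set.univ M).continuous⟩ : C(↥(univ : Set M), M)) =
        ContinuousMap.id _ := by
      ext x
      exact congrArg Subtype.val ((Homeomorph.Set.univ M).symm_apply_apply x)
    rw [this, singularCohomology.map_id]
    rfl
  obtain ⟨w, hw⟩ := hsurj ((subsetCochains.homologyIsoSingularCohomology ℝ (univ : Set M) k).hom y)
  refine ⟨w, (subsetCochains.homologyIsoSingularCohomology ℝ (univ : Set M) k).toLinearEquiv.injective ?_⟩
  change (subsetCochains.homologyIsoSingularCohomology ℝ (univ : Set M) k).hom _ =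
    (subsetCochains.homologyIsoSingularCohomology ℝ (univ : Set M) k).hom y
  rw [subsetCochains.homologyIsoSingularCohomology_hom_thetaInv]
  exact hw

end Literature.Geometry.Manifold
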